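import Summits.RiemannHypothesis.RiemannHypothesis.Theses.SpectralTrace
import Literature.NumberTheory.DiophantineGeometry.NamedHypotheses

/-!
# Sketch — crux-ideate round 1, ideator 2, crux `WindowTraceArch` (stmt-RiemannHypothesis-11195)

First lemmas of the three idea cards (they need not be proved; they must elaborate):

* `WindowSynthesis`        — card `poisson-density-newton-kantorovich`  (density-channel exact synthesis)
* `TailCrystallisation`, `zetaSeedReduction` — card `zeta-seed-recrystallisation`
* `ExoticKernelWindow`     — card `exotic-conductor-one-kernel`
-/

noncomputable section

open Complex Filter Set MeasureTheory
open scoped Real Topology ContDiff ComplexConjugate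

namespace Summit.RiemannHypothesis.RiemannHypothesis.Cruxes.WindowTraceArch.Ideator2

open Literature.NumberTheory.LFunctions
open Summit.RiemannHypothesis.RiemannHypothesis.Theses.SpectralTrace

/-! ## Card 1: density-channel synthesis (first lemma of `poisson-density-newton-kantorovich`) -/

/-- **Window synthesis through the Poisson density channel.** If `x : ℕ → ℝ` is asymptotically a
lattice of mesh `h` (`x n - h n → 0`) with `h * A < π` (the lattice period `2π/h` exceeds the window
length `2A`), then every smooth odd real `ψ` is synthesised EXACTLY on the window `(-A, A)` by a
rapidly decaying real sine series over the points `x n`:  `2 ∑ δ_n sin(x_n t) = ψ(t)`, `|t| < A`,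
in the sense of pairings with window Weil tests. (Fourier series on the period `2π/h ⊃ [-A, A]`
with finitely many moment conditions in the collar, then a Neumann series in `x n - h n`.) -/
def WindowSynthesis : Prop :=
  ∀ (A h : ℝ), 0 < A → 0 < h → h * A < π → ∀ (x : ℕ → ℝ),
    Tendsto (fun n => x n - h * n) atTop (𝓝 0) →
    ∀ ψ : ℝ → ℝ, ContDiff ℝ ∞ ψ → (∀ t, ψ (-t) = -ψ t) →
    ∃ δ : ℕ → ℝ, (∀ N : ℕ, Summable fun n => |δ n| * (1 + |x n|) ^ N) ∧
      ∀ g : ℝ → ℂ, IsWeilTest g → tsupport g ⊆ Icc (-A) A →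
        HasSum (fun n => (δ n : ℂ) * ∫ t, g t * (Real.sin (x n * t) : ℂ))
          ((1 / 2 : ℂ) * ∫ t, g t * (ψ t : ℂ))

/-! ## Card 2: zeta-seed re-crystallisation -/

/-- **Tail crystallisation above height `H`.** Some real family reproduces, on the window
`[-log 2, log 2]`, the Weil functional MINUS the (finite, unconditional) zero side of `ζ` up to
height `H` (`weilZeroSidePartial g H = ∑_{|Im ρ| ≤ H} m(ρ) ĝ(ρ)`). For `H` below the first zero this
IS the crux; for large `H` it is the soft (over-capacity) regime of the card. -/
def TailCrystallisation (H : ℝ) : Prop :=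
  ∃ (ι : Type) (y : ι → ℝ), ∀ g : ℝ → ℂ, IsWeilTest g →
    tsupport g ⊆ Icc (-Real.log 2) (Real.log 2) →
      HasSum (fun i => weilMellin g (1 / 2 + (y i : ℂ) * I))
        (weilFunctional g - weilZeroSidePartial g H)

/-- **Zeta-seed reduction** (frame of the card, provable now): RH verified up to height `H`
(`RiemannHypothesisUpTo H`, e.g. the tree's `riemannHypothesisUpTo_sixteen`, or Platt–Trudgian) plus
tail crystallisation above `H` give the crux: the zeros with `|Im ρ| ≤ H` are `1/2 + iγ` and enter as a
finite family of unit atoms (multiplicity = repetition). -/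
def zetaSeedReduction : Prop :=
  ∀ H : ℝ, 0 < H → Literature.NumberTheory.DiophantineGeometry.RiemannHypothesisUpTo H →
    TailCrystallisation H → WindowTraceArch

/-! ## Card 3: exotic conductor-one kernels -/

/-- The archimedean kernel of `ζ`: `φ(u) = 2(2π² e^{9u/2} − 3π e^{5u/2}) e^{−π e^{2u}}`, whose
two-sided Laplace transform `∫ φ(u) e^{(s-1/2)u} du` is `ξ_∞(s) = ½ s(s−1) π^{-s/2} Γ(s/2)`; Riemann's
`Φ(u) = ∑_{n ≥ 1} n^{-1/2} φ(u + log n)` (log-translates weighted so that `Φ̂ = ξ_∞ · ζ`). -/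
def archKernel (u : ℝ) : ℝ :=
  2 * (2 * π ^ 2 * Real.exp (9 * u / 2) - 3 * π * Real.exp (5 * u / 2)) * Real.exp (-π * Real.exp (2 * u))

/-- A superposition of log-translates of `archKernel` by shifts `ℓ k` with weights `c k`. -/
def exoticKernel (c ℓ : ℕ → ℝ) (u : ℝ) : ℝ :=
  ∑' k, c k * archKernel (u + ℓ k)

/-- Its "Ξ-function": `Ξ(z) = ∫ Φ(u) e^{izu} du` (= `weilMellin Φ (1/2 + iz)`). -/
def exoticXi (c ℓ : ℕ → ℝ) (z : ℂ) : ℂ :=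
  weilMellin (fun u => (exoticKernel c ℓ u : ℂ)) (1 / 2 + z * I)

/-- **Exotic conductor-one kernels witness the archimedean rung.** Let `ℓ 0 = 0`, `c 0 = 1`, all
other shifts `ℓ k ≥ log 2` (window-invisible "primes"), with absolute convergence of the generalised
Dirichlet series `∑ c k e^{ℓ k /2} e^{-σ ℓ k}` for some `σ`. If the kernel `Φ = ∑ c k φ(· + ℓ k)` is
EVEN (⟺ Riemann-type functional equation ⟺ `(c, e^{ℓ})` is a self-dual crystalline datum,
Kahane–Mandelbrojt 1958 Thms 1–2) and `Ξ_Φ` has ONLY REAL ZEROS (encoded: a real family `γ` whose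
fibres count the analytic order of `Ξ_Φ` everywhere in `ℂ`), then `γ` realises the crux window
identity. (Explicit formula for `Ξ_Φ`: the shifted kernels contribute only at `|t| = ℓ k ≥ log 2`.) -/
def ExoticKernelWindow : Prop :=
  ∀ (c ℓ : ℕ → ℝ), c 0 = 1 → ℓ 0 = 0 → (∀ k, 1 ≤ k → Real.log 2 ≤ ℓ k) →
    (∃ σ : ℝ, Summable fun k => |c k| * Real.exp (ℓ k / 2) * Real.exp (-σ * ℓ k)) →
    (∀ u, exoticKernel c ℓ (-u) = exoticKernel c ℓ u) →
    ∀ (ι : Type) (γ : ι → ℝ),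
      (∀ z : ℂ, {i : ι | ((γ i : ℝ) : ℂ) = z}.encard = (analyticOrderNatAt (exoticXi c ℓ) z : ℕ∞)) →
      ∀ g : ℝ → ℂ, IsWeilTest g → tsupport g ⊆ Icc (-Real.log 2) (Real.log 2) →
        HasSum (fun i => weilMellin g (1 / 2 + (γ i : ℂ) * I)) (weilFunctional g)

/-- Sanity: `ExoticKernelWindow` delivers the crux from any admissible datum. -/
theorem windowTraceArch_of_exoticKernel (h : ExoticKernelWindow) (c ℓ : ℕ → ℝ) (hc : c 0 = 1)
    (hℓ : ℓ 0 = 0) (hgap : ∀ k, 1 ≤ k → Real.log 2 ≤ ℓ k)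
    (hsum : ∃ σ : ℝ, Summable fun k => |c k| * Real.exp (ℓ k / 2) * Real.exp (-σ * ℓ k))
    (heven : ∀ u, exoticKernel c ℓ (-u) = exoticKernel c ℓ u) (ι : Type) (γ : ι → ℝ)
    (hzeros : ∀ z : ℂ, {i : ι | ((γ i : ℝ) : ℂ) = z}.encard =
      (analyticOrderNatAt (exoticXi c ℓ) z : ℕ∞)) :
    WindowTraceArch :=
  ⟨ι, γ, fun g hg hgs => h c ℓ hc hℓ hgap hsum heven ι γ hzeros g hg hgs⟩

/-- Sanity: the zeta-seed frame concludes the crux BY NAME. -/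
theorem windowTraceArch_of_zetaSeed (h : zetaSeedReduction) {H : ℝ} (hH : 0 < H)
    (hRH : Literature.NumberTheory.DiophantineGeometry.RiemannHypothesisUpTo H)
    (hT : TailCrystallisation H) : WindowTraceArch :=
  h H hH hRH hT

end Summit.RiemannHypothesis.RiemannHypothesis.Cruxes.WindowTraceArch.Ideator2

end
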